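import Summits.BirchSwinnertonDyer.BirchSwinnertonDyer.Theorems.EisensteinDepletionAtTwoStarEtaLogDerivative
import HarnessLib

/-!
# Route `EisensteinDepletionAtTwo`, crux E1M `DepletedLambdaLawAtTwo` (stmt-BirchSwinnertonDyer-20341), line `star`:
# the `η`-parity lemma at the level of `q`-expansions, for actual `η`-quotients

Cell `bsd-rank2`, seat `bsd-rank2-eng-2` GEN 12; helper `--supports stmt-BirchSwinnertonDyer-20341`; sequel (split for the
400-line rule) of `EisensteinDepletionAtTwoStarEtaLogDerivative` (§1–§6: `X·F' = −F·Σσ(m)Xᵐ`, the logarithmic derivative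
of `∏_δ F_δ^{r_δ}`, mod `2` the `θ_δ`, and "`ū` is a square in `𝔽₂⟦X⟧` iff all `r_δ` are even").  HONEST FRAMING: formal
power series and Mathlib's analytic `qExpansion`; nothing here reads an analytic rank, nothing here proves
(★-SymbGlobal) / `StarGO2` / `StarOptB` / E1M; BSD is not proved by any of this (PARTITION D-0054: none — r_an ≥ 2 axis
S0, door T-r3₂).

## Contents

* `qExpansion_prod_of_isIntUnitQExp`, `qExpansion_eulerFn_pow`, `qExpansion_eulerFn_zpow` — `qExpansion 1` is
  multiplicative on functions with integral unit `q`-expansions (Mathlib `qExpansion_mul`), so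
  `qExpansion 1 ((∏_n(1 − q^{δn}))^n) = F_δ^n` for every integer `n` (`F_δ = formalEulerScaled δ` as a unit of `ℤ⟦X⟧`);
* **`qExpansion_etaQuotient_eq_map_prod_zpow`** — for `Σ_{δ ∣ N} δ r_δ = 0`, the `q`-expansion of the `η`-quotient
  `etaQuotient N r = ∏_{δ ∣ N} η(δτ)^{r_δ}` (`Literature.….ModularCurveEtaQuotientsProofs`) IS `∏_{δ ∣ N} F_δ^{r_δ}`,
  explicitly (the integer series whose existence is `exists_int_map_eq_qExpansion_etaQuotient`);
* **`isSquare_map_zmod_two_qExpansion_etaQuotient_iff`** — for `N` odd squarefree and `Σ δ r_δ = 0`: the integer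
  `q`-expansion of `∏_{δ ∣ N} η(δτ)^{r_δ}` is a square mod `2` iff every `r_δ` (`δ ∣ N`) is even.  This is the
  `q`-expansion-level form of bsd-rank2-p2 GEN 22's `η`-parity lemma (R1-placement §8.10–8.11: "`[½ div g]` is
  multiplicative at `2` iff all `r_δ` even"); the passage `𝔽₂(X₀(N)) ↪ 𝔽₂((q))` and the arithmetic step are not
  formalised (no `X₀(N)_{𝔽₂}` in the tree).
-/

set_option linter.dupNamespace false
set_option autoImplicit false

open Finset ArithmeticFunction PowerSeries
open scoped ArithmeticFunction.sigma

namespace Summit.BirchSwinnertonDyer.BirchSwinnertonDyer.Theorems.DepletionAtTwo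

open Literature.NumberTheory.EllipticCurves.ModularForms

/-! ### The `q`-expansion of an `η`-quotient `∏_δ η(δτ)^{r_δ}` (`Σ δ r_δ = 0`) IS `∏_δ F_δ^{r_δ}`, explicitly -/

section EtaQuotient

open UpperHalfPlane hiding I
open scoped MatrixGroups Manifold ModularForm

/-- `qExpansion` is multiplicative on finite products of functions with integral unit `q`-expansions.
[folklore] -/
theorem qExpansion_prod_of_isIntUnitQExp {ι : Type*} (s : Finset ι) {G : ι → ℍ → ℂ}
    (h : ∀ i ∈ s, IsIntUnitQExp (G i)) :
    qExpansion 1 (∏ i ∈ s, G i) = ∏ i ∈ s, qExpansion 1 (G i) := by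
  classical
  induction s using Finset.induction_on with
  | empty => rw [Finset.prod_empty, Finset.prod_empty, qExpansion_one]
  | insert a s ha ih =>
    rw [Finset.prod_insert ha, Finset.prod_insert ha,
      qExpansion_mul (h a (Finset.mem_insert_self a s)).analyticAt
        (IsIntUnitQExp.prod s fun i hi ↦ h i (Finset.mem_insert_of_mem hi)).analyticAt,
      ih fun i hi ↦ h i (Finset.mem_insert_of_mem hi)]

/-- `qExpansion 1 ((∏(1 − q^{δn}))^k) = F_δ^k`. [folklore] -/
theorem qExpansion_eulerFn_pow {δ : ℕ} (hδ : 0 < δ) (k : ℕ) :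
    qExpansion 1 (eulerFn δ ^ k) = ((formalEulerScaled δ).map (Int.castRingHom ℂ)) ^ k := by
  induction k with
  | zero => rw [pow_zero, pow_zero, qExpansion_one]
  | succ k ih =>
    rw [pow_succ, pow_succ, qExpansion_mul ((isIntUnitQExp_eulerFn hδ).pow k).analyticAt
      (isIntUnitQExp_eulerFn hδ).analyticAt, ih, qExpansion_eulerFn hδ]

/-- `qExpansion 1 ((∏(1 − q^{δn}))^n) = F_δ^n` for every INTEGER `n`, `F_δ` as a unit of `ℤ⟦X⟧`. [folklore] -/
theorem qExpansion_eulerFn_zpow {δ : ℕ} (hδ : 0 < δ) (n : ℤ) :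
    qExpansion 1 (fun τ ↦ eulerFn δ τ ^ n) =
      (((isUnit_formalEulerScaled δ).unit ^ n).val).map (Int.castRingHom ℂ) := by
  cases n with
  | ofNat k =>
    have hfun : (fun τ ↦ eulerFn δ τ ^ (Int.ofNat k)) = eulerFn δ ^ k := by
      funext τ; simp
    rw [hfun, qExpansion_eulerFn_pow hδ, Int.ofNat_eq_natCast, zpow_natCast, Units.val_pow_eq_pow_val,
      IsUnit.unit_spec, map_pow]
  | negSucc k =>
    have hfun : (fun τ ↦ eulerFn δ τ ^ (Int.negSucc k)) = (eulerFn δ ^ (k + 1))⁻¹ := by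
      funext τ; simp [zpow_negSucc]
    have hg : IsIntUnitQExp (eulerFn δ ^ (k + 1)) := (isIntUnitQExp_eulerFn hδ).pow (k + 1)
    have hne : ∀ τ : ℍ, (eulerFn δ ^ (k + 1)) τ ≠ 0 := fun τ ↦ by
      simpa using pow_ne_zero (k + 1) (eulerFn_ne_zero hδ τ)
    have hinv : IsIntUnitQExp (eulerFn δ ^ (k + 1))⁻¹ := hg.inv hne
    -- `Q(g⁻¹) · Q(g) = 1` and `Q(g) = F_δ^{k+1}`
    have hfun1 : (eulerFn δ ^ (k + 1))⁻¹ * eulerFn δ ^ (k + 1) = 1 :=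
      funext fun τ ↦ inv_mul_cancel₀ (hne τ)
    have key : qExpansion 1 (eulerFn δ ^ (k + 1))⁻¹ *
        (((isUnit_formalEulerScaled δ).unit ^ (k + 1)).val).map (Int.castRingHom ℂ) = 1 := by
      rw [Units.val_pow_eq_pow_val, IsUnit.unit_spec, map_pow, ← qExpansion_eulerFn_pow hδ,
        ← qExpansion_mul hinv.analyticAt hg.analyticAt, hfun1, qExpansion_one]
    have hunit : (((isUnit_formalEulerScaled δ).unit ^ (k + 1)).val).map (Int.castRingHom ℂ) *
        ((((isUnit_formalEulerScaled δ).unit ^ (k + 1))⁻¹).val).map (Int.castRingHom ℂ) = 1 := by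
      rw [← map_mul, Units.mul_inv, map_one]
    rw [hfun, zpow_negSucc]
    calc qExpansion 1 (eulerFn δ ^ (k + 1))⁻¹
        = qExpansion 1 (eulerFn δ ^ (k + 1))⁻¹ *
            ((((isUnit_formalEulerScaled δ).unit ^ (k + 1)).val).map (Int.castRingHom ℂ) *
              ((((isUnit_formalEulerScaled δ).unit ^ (k + 1))⁻¹).val).map (Int.castRingHom ℂ)) := by
          rw [hunit, mul_one]
      _ = _ := by rw [← mul_assoc, key, one_mul]

/-- **The `q`-expansion of an `η`-quotient, explicitly**: for `Σ_{δ ∣ N} δ r_δ = 0`,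
`qExpansion 1 (∏_δ η(δτ)^{r_δ}) = ∏_{δ ∣ N} F_δ^{r_δ}` (image in `ℂ⟦q⟧` of a unit of `ℤ⟦q⟧`,
`F_δ = ∏_{n ≥ 1}(1 − q^{δn})`) — the integer series whose existence is
`exists_int_map_eq_qExpansion_etaQuotient`. [folklore] -/
theorem qExpansion_etaQuotient_eq_map_prod_zpow (N : ℕ) (r : ℕ → ℤ)
    (hS : ∑ δ ∈ N.divisors, (δ : ℤ) * r δ = 0) :
    qExpansion 1 (etaQuotient N r) =
      ((∏ δ ∈ N.divisors, (isUnit_formalEulerScaled δ).unit ^ r δ).val).map (Int.castRingHom ℂ) := by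
  have heq : etaQuotient N r = ∏ δ ∈ N.divisors, fun τ ↦ eulerFn δ τ ^ r δ := by
    funext τ
    rw [etaQuotient_eq_prod_eulerFn_zpow N r hS τ, Finset.prod_apply]
  rw [heq, qExpansion_prod_of_isIntUnitQExp _ fun δ hδ ↦ (isIntUnitQExp_eulerFn
      (Nat.pos_of_mem_divisors hδ)).zpow (eulerFn_ne_zero (Nat.pos_of_mem_divisors hδ)) (r δ),
    Units.coe_prod, map_prod]
  exact Finset.prod_congr rfl fun δ hδ ↦ qExpansion_eulerFn_zpow (Nat.pos_of_mem_divisors hδ) (r δ)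

/-- **The `η`-parity lemma at the level of `q`-expansions, for `η`-quotients.**  Let `N` be odd and squarefree,
`r : ℕ → ℤ` with `Σ_{δ ∣ N} δ r_δ = 0`, and let `P ∈ ℤ⟦q⟧` be the (unique) integer series with
`P = qExpansion 1 (∏_{δ ∣ N} η(δτ)^{r_δ})` in `ℂ⟦q⟧` (`exists_int_map_eq_qExpansion_etaQuotient`).  Then
**`P mod 2` is a square in `𝔽₂⟦q⟧` iff every `r_δ` (`δ ∣ N`) is even.** [folklore] -/
theorem isSquare_map_zmod_two_qExpansion_etaQuotient_iff {N : ℕ} (hN : Odd N) (hsf : Squarefree N)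
    (r : ℕ → ℤ) (hS : ∑ δ ∈ N.divisors, (δ : ℤ) * r δ = 0) {P : PowerSeries ℤ}
    (hP : P.map (Int.castRingHom ℂ) = qExpansion 1 (etaQuotient N r)) :
    IsSquare (P.map (Int.castRingHom (ZMod 2))) ↔ ∀ δ ∈ N.divisors, Even (r δ) := by
  have hinj : Function.Injective (PowerSeries.map (Int.castRingHom ℂ)) :=
    PowerSeries.map_injective _ (RingHom.injective_int _)
  rw [qExpansion_etaQuotient_eq_map_prod_zpow N r hS] at hP
  rw [hinj hP]
  refine isSquare_map_zmod_two_prod_formalEulerScaled_zpow_iff (fun δ hδ ↦ ?_) r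
  have hδN : δ ∣ N := Nat.dvd_of_mem_divisors hδ
  exact ⟨hN.of_dvd_nat hδN, hsf.squarefree_of_dvd hδN⟩

end EtaQuotient

end Summit.BirchSwinnertonDyer.BirchSwinnertonDyer.Theorems.DepletionAtTwo
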